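import Literature.MathematicalPhysics.QuantumLattice.GroundStateSourceBounds
import Literature.MathematicalPhysics.QuantumLattice.DWaveSource
import Literature.MathematicalPhysics.QuantumLattice.HubbardGaugeBound
import Literature.Barriers.HubbardSuperconductivity.HohenbergMerminWagnerPairing
import HarnessLib

/-!
# The `d`-wave source on Hubbard tori: `U(1)`, a priori bounds, monotonicity and the energy sandwich

API lemmas for `DWaveSource.lean` (`dWaveSourceTorus`, `dWaveSourceDensity`), family `hubbard` / trunk
T-QLATTICE; written by the standing disprover of crux `WcbcsBcsConstruction` (route
`HubbardSuperconductivity/WeakCouplingBCS`), whose order clause is `exp(-C/U²) ≤ dWaveOrderParameter U μ`.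
All statements are proved; no named facts.

* `U(1)` / particle-number conservation in Koma–Tasaki's gauge form: the constant gauge transformation
  `e^{-cN}` commutes with `hamiltonianWith G t U μ`, so the source-FREE tracial ground state kills every
  singlet bond pair (`bondPair`, `HohenbergMerminWagnerPairing`), every `localPair` and every
  `pairField`, on every finite graph /
  torus and for all `t, U, μ` (`groundStateFunctional_hubbardTorusWith_pairField`); hence
  `dWaveSourceDensity L U μ 0 = 0` (`dWaveSourceDensity_zero`).
* A priori bounds (`‖b_{uv}‖ ≤ 2` from `HohenbergMerminWagnerPairing`): `‖P_x‖ ≤ 2Σ_e |g e/√2|`, `‖Δ_g‖ ≤ 2Σ_e|g e/√2| · L²`, and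
  `|dWaveSourceDensity L U μ h| ≤ 2Σ_e |d e/√2| (= 4√2)` for ALL `U, μ, h` (`abs_dWaveSourceDensity_le`).
* The sourced torus `H_{L,h} = K - hO`, `O = Δ_d + Δ_d†`: `Re ω_h(O) = 2L² · dWaveSourceDensity`, hence
  (from `GroundStateSourceBounds`) `h ↦ dWaveSourceDensity L U μ h` is MONOTONE, `≥ 0` for `h ≥ 0` and
  `≤ 0` for `h ≤ 0`, the source never raises the ground-state energy, and the ENERGY SANDWICH
  `E(0) - E(h) ≤ 2hL²·density(h)`, `(h'-h)·2L²·density(h) ≤ E(h) - E(h')`.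

Sources: T. Koma, H. Tasaki, J. Stat. Phys. 76 (1994) 745, §1 (order parameter under a source; the
inequalities are folklore); T. Koma, H. Tasaki, PRL 68 (1992) 3248, eqs. (5)–(8) (gauge transformation);
D. J. Scalapino, Phys. Rep. 250 (1995) 329, §2 (the pair field). Tree search: `lean search
"dWaveSourceDensity_|groundStateFunctional_hubbardTorusWith"` — only the unfolding lemmas of
`DWaveSource.lean`.
-/

noncomputable section

namespace Literature.MathematicalPhysics.QuantumLattice

open Matrix Finset Filter Literature.Probability.LatticeModels Literature.Barriers.HubbardSuperconductivity
open scoped Matrix.Norms.L2Operator ComplexOrder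

/-! ### `U(1)`: no anomalous averages in the source-free tracial ground state -/

section GaugeInvariance

variable {Λ : Type*} [LinearOrder Λ] [Fintype Λ] (G : SimpleGraph Λ) [DecidableRel G.Adj]

/-- The CONSTANT Koma–Tasaki gauge transformation `e^{-c N}` leaves the grand-canonical Hubbard
Hamiltonian invariant (particle-number conservation, in conjugation form).
[cite: KomaTasakiPRL1992, eq. (7)] -/
theorem siteGauge_const_conj_hamiltonianWith (c t U μ : ℝ) :
    siteGauge (fun _ : Λ => c) * hamiltonianWith G t U μ * siteGauge (-fun _ : Λ => c) =
      hamiltonianWith G t U μ := by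
  rw [siteGauge_mul_hamiltonianWith_mul, hamiltonianWith_eq_hoppingForm]
  simp only [sub_self, Real.exp_zero]

/-- Hence the constant gauge transformation commutes with the Hamiltonian. [folklore] -/
theorem siteGauge_const_mul_hamiltonianWith (c t U μ : ℝ) :
    siteGauge (fun _ : Λ => c) * hamiltonianWith G t U μ =
      hamiltonianWith G t U μ * siteGauge (fun _ : Λ => c) := by
  have h := siteGauge_const_conj_hamiltonianWith G c t U μ
  calc siteGauge (fun _ : Λ => c) * hamiltonianWith G t U μ
      = siteGauge (fun _ : Λ => c) * hamiltonianWith G t U μ *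
          (siteGauge (-fun _ : Λ => c) * siteGauge (fun _ : Λ => c)) := by
        rw [siteGauge_neg_mul_siteGauge, mul_one]
    _ = siteGauge (fun _ : Λ => c) * hamiltonianWith G t U μ * siteGauge (-fun _ : Λ => c) *
          siteGauge (fun _ : Λ => c) := by rw [← mul_assoc]
    _ = hamiltonianWith G t U μ * siteGauge (fun _ : Λ => c) := by rw [h]

/-- **No anomalous bond-pair average in the source-free tracial ground state**: for the
grand-canonical Hubbard Hamiltonian on ANY finite graph, any `t, U, μ` and any bond `(u, v)`,
`ω₀(b_{uv}) = 0` for the singlet bond pair `b_{uv} = c_{u↑}c_{v↓} - c_{u↓}c_{v↑}` — the gauge rotation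
multiplies `b_{uv}` by `e² ≠ 1` and leaves `ω₀` invariant. [cite: KomaTasakiPRL1992, eqs. (5)–(8)] -/
theorem groundStateFunctional_hamiltonianWith_bondPair (t U μ : ℝ) (u v : Λ) :
    (hamiltonianWith G t U μ).groundStateFunctional (bondPair u v) = 0 := by
  have hH := isHermitian_hamiltonianWith G t U μ
  have hcomm := siteGauge_const_mul_hamiltonianWith G 1 t U μ
  have hinv : siteGauge (-fun _ : Λ => (1 : ℝ)) * siteGauge (fun _ : Λ => (1 : ℝ)) = 1 :=
    siteGauge_neg_mul_siteGauge _
  have h1 := groundStateFunctional_conj_of_commute_of_inverse hH hcomm hinv (bondPair u v)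
  rw [siteGauge_mul_bondPair_mul, LinearMap.map_smul_of_tower, smul_eq_mul] at h1
  have hne : ((Real.exp ((1 : ℝ) + 1) : ℝ) : ℂ) - 1 ≠ 0 := by
    rw [sub_ne_zero, Ne, Complex.ofReal_eq_one, Real.exp_eq_one_iff]
    norm_num
  have h2 : (((Real.exp ((1 : ℝ) + 1) : ℝ) : ℂ) - 1) *
      (hamiltonianWith G t U μ).groundStateFunctional (bondPair u v) = 0 := by
    rw [sub_mul, one_mul, sub_eq_zero]
    exact h1
  exact (mul_eq_zero.1 h2).resolve_left hne

variable (g : Site 2 → ℝ) (L : ℕ) [NeZero L]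

/-- No anomalous local-pair average without a source on the Hubbard torus (every form factor).
[cite: KomaTasakiPRL1992, eqs. (5)–(8)] -/
theorem groundStateFunctional_hubbardTorusWith_localPair (t U μ : ℝ) (x : TorusSite 2 L) :
    (hubbardTorusWith 2 L t U μ).groundStateFunctional (localPair g L x) = 0 := by
  rw [localPair_eq_sum_bondPair, map_sum]
  refine Finset.sum_eq_zero fun e _ => ?_
  rw [LinearMap.map_smul_of_tower, smul_eq_zero]
  right
  have h0 := groundStateFunctional_hamiltonianWith_bondPair (fermionTorusGraph 2 L) t U μ
    (FermionTorus.ofTorusSite x) (FermionTorus.ofTorusSite (x + Torus.proj L e))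
  unfold hubbardTorusWith
  convert h0 using 4

/-- **No pair-field average without a source** (`U(1)` invariance of the tracial ground state):
`ω₀[H(t,U) - μN](Δ_g) = 0` on every torus, for every form factor `g` and all `t, U, μ`.
[cite: KomaTasaki1994, §1] -/
theorem groundStateFunctional_hubbardTorusWith_pairField (t U μ : ℝ) :
    (hubbardTorusWith 2 L t U μ).groundStateFunctional (pairField g L) = 0 := by
  rw [pairField, map_sum]
  exact Finset.sum_eq_zero fun x _ => groundStateFunctional_hubbardTorusWith_localPair g L t U μ x

/-- The `h = 0` slice of the `d`-wave source density vanishes identically: the source `h > 0` (and the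
order of limits in `dWaveOrderParameter`) is what makes the order parameter non-trivial.
[cite: KomaTasaki1994, §1] -/
theorem dWaveSourceDensity_zero (U μ : ℝ) : dWaveSourceDensity L U μ 0 = 0 := by
  rw [dWaveSourceDensity, dWaveSourceTorus_zero, groundStateFunctional_hubbardTorusWith_pairField]
  simp

end GaugeInvariance

/-! ### A priori bounds -/

section Bounds

variable (g : Site 2 → ℝ) (L : ℕ) [NeZero L]

/-- `‖P_x‖ ≤ 2 Σ_{e ∈ {0,±e₁,±e₂}} |g e/√2|` (`‖c‖ ≤ 1`). [folklore] -/
theorem norm_localPair_le (x : TorusSite 2 L) :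
    ‖localPair g L x‖ ≤ 2 * ∑ e ∈ insert (0 : Site 2) unitSteps, |g e / Real.sqrt 2| := by
  rw [localPair_eq_sum_bondPair, Finset.mul_sum]
  refine (norm_sum_le _ _).trans (Finset.sum_le_sum fun e _ => ?_)
  rw [norm_smul, Complex.norm_real, Real.norm_eq_abs, mul_comm]
  exact mul_le_mul_of_nonneg_right (norm_bondPair_le_two _ _) (abs_nonneg _)

/-- `|Λ_L| = L²` for the two-dimensional torus (private copy of `card_torusSite_two` of
`TorusCooperSum.lean`, not imported here). [folklore] -/
private theorem card_torusSite_two_aux : Fintype.card (TorusSite 2 L) = L ^ 2 := by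
  simp [TorusSite, ZMod.card]

/-- `‖Δ_g‖ ≤ 2 Σ_e |g e/√2| · L²`. [cite: Scalapino1995, §2] -/
theorem norm_pairField_le :
    ‖pairField g L‖ ≤ (2 * ∑ e ∈ insert (0 : Site 2) unitSteps, |g e / Real.sqrt 2|) * (L : ℝ) ^ 2 := by
  rw [pairField]
  refine (norm_sum_le _ _).trans ?_
  calc ∑ x : TorusSite 2 L, ‖localPair g L x‖
      ≤ ∑ _x : TorusSite 2 L, 2 * ∑ e ∈ insert (0 : Site 2) unitSteps, |g e / Real.sqrt 2| :=
        Finset.sum_le_sum fun x _ => norm_localPair_le g L x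
    _ = (2 * ∑ e ∈ insert (0 : Site 2) unitSteps, |g e / Real.sqrt 2|) * (L : ℝ) ^ 2 := by
        rw [Finset.sum_const, Finset.card_univ, card_torusSite_two_aux, nsmul_eq_mul]
        push_cast
        ring

omit [NeZero L] in
/-- The grand-canonical torus Hubbard Hamiltonian is Hermitian (unconditional form of
`hubbardTorusWith_isHermitian`). [folklore] -/
theorem isHermitian_hubbardTorusWith (t U μ : ℝ) : (hubbardTorusWith 2 L t U μ).IsHermitian :=
  isHermitian_hamiltonianWith _ t U μ

/-- `0 < L²` as a real number, for `L ≠ 0`. [folklore] -/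
theorem cast_sq_pos_of_neZero : (0 : ℝ) < (L : ℝ) ^ 2 := by
  have : (0 : ℝ) < L := by exact_mod_cast Nat.pos_of_ne_zero (NeZero.ne L)
  positivity

/-- **A priori bound on the sourced pair density**, for ALL `U, μ, h`:
`|dWaveSourceDensity L U μ h| ≤ 2 Σ_e |d(e)/√2| = 4√2`. In particular the real `liminf`s defining
`dWaveOrderParameter` are never junk. [folklore] -/
theorem abs_dWaveSourceDensity_le (U μ h : ℝ) :
    |dWaveSourceDensity L U μ h| ≤ 2 * ∑ e ∈ insert (0 : Site 2) unitSteps, |dWaveFormFactor e / Real.sqrt 2| := by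
  have hHh := dWaveSourceTorus_isHermitian L (isHermitian_hubbardTorusWith L 1 U μ) h
  have hL := cast_sq_pos_of_neZero L
  rw [dWaveSourceDensity, abs_div, abs_of_pos hL, div_le_iff₀ hL]
  exact (abs_re_groundStateFunctional_le_norm hHh _).trans (norm_pairField_le dWaveFormFactor L)

end Bounds

/-! ### The sourced torus: `Re ω_h(Δ_d + Δ_d†) = 2L²·density`, monotonicity, sign, energy sandwich -/

section Sandwich

variable (L : ℕ) [NeZero L]

/-- `H_{L,h} = K - h O` with `O = Δ_d + Δ_d†` (definitional). [cite: KomaTasaki1994, §1] -/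
theorem dWaveSourceTorus_eq (U μ h : ℝ) :
    dWaveSourceTorus L U μ h = hubbardTorusWith 2 L 1 U μ -
      (h : ℂ) • (pairField dWaveFormFactor L + (pairField dWaveFormFactor L)ᴴ) := rfl

/-- `Re ω_h(Δ_d + Δ_d†) = 2 L² · dWaveSourceDensity` (the density is `Re ω_h(Δ_d)/L²` and
`Re ω(Δ_d†) = Re ω(Δ_d)`): the tree's order parameter is HALF of Koma–Tasaki's for `O = Δ_d + Δ_d†`.
[cite: KomaTasaki1994, §1] -/
theorem re_groundStateFunctional_dWaveSource_op (U μ h : ℝ) :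
    ((dWaveSourceTorus L U μ h).groundStateFunctional
        (pairField dWaveFormFactor L + (pairField dWaveFormFactor L)ᴴ)).re =
      2 * (L : ℝ) ^ 2 * dWaveSourceDensity L U μ h := by
  have hL : (L : ℝ) ≠ 0 := by exact_mod_cast NeZero.ne L
  rw [map_add, Complex.add_re, groundStateFunctional_conjTranspose_re, dWaveSourceDensity]
  field_simp
  ring

variable {L}

/-- **Monotonicity in the source**: `h ↦ dWaveSourceDensity L U μ h` is non-decreasing on `ℝ`
(concavity of the sourced ground-state energy). [cite: KomaTasaki1994, §1] -/
theorem dWaveSourceDensity_mono (U μ : ℝ) {h h' : ℝ} (hle : h ≤ h') :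
    dWaveSourceDensity L U μ h ≤ dWaveSourceDensity L U μ h' := by
  have key := re_groundStateFunctional_source_mono (isHermitian_hubbardTorusWith L 1 U μ)
    (isHermitian_pairField_add_conjTranspose L) hle
  rw [← dWaveSourceTorus_eq, ← dWaveSourceTorus_eq, re_groundStateFunctional_dWaveSource_op,
    re_groundStateFunctional_dWaveSource_op] at key
  have hL : (0 : ℝ) < 2 * (L : ℝ) ^ 2 := by
    have := cast_sq_pos_of_neZero L
    positivity
  exact le_of_mul_le_mul_left key hL

/-- **Sign of the sourced density**: `0 ≤ dWaveSourceDensity L U μ h` for `h ≥ 0` — for every `L, U, μ`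
(so no sign consideration can refute a positive floor on the order parameter). [cite: KomaTasaki1994, §1] -/
theorem dWaveSourceDensity_nonneg (U μ : ℝ) {h : ℝ} (hh : 0 ≤ h) : 0 ≤ dWaveSourceDensity L U μ h := by
  rw [← dWaveSourceDensity_zero L U μ]
  exact dWaveSourceDensity_mono U μ hh

/-- … and `dWaveSourceDensity L U μ h ≤ 0` for `h ≤ 0`. [cite: KomaTasaki1994, §1] -/
theorem dWaveSourceDensity_nonpos (U μ : ℝ) {h : ℝ} (hh : h ≤ 0) : dWaveSourceDensity L U μ h ≤ 0 := by
  rw [← dWaveSourceDensity_zero L U μ]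
  exact dWaveSourceDensity_mono U μ hh

/-- The source never raises the ground-state energy: `E₀(H_{L,h}) ≤ E₀(H_{L,0})` for every real `h`.
[cite: KomaTasaki1994, §1] -/
theorem groundEnergy_dWaveSourceTorus_le (U μ h : ℝ) :
    (dWaveSourceTorus L U μ h).groundEnergy ≤ (dWaveSourceTorus L U μ 0).groundEnergy := by
  have h0 : ((hubbardTorusWith 2 L 1 U μ).groundStateFunctional
      (pairField dWaveFormFactor L + (pairField dWaveFormFactor L)ᴴ)).re = 0 := by
    rw [map_add, Complex.add_re, groundStateFunctional_conjTranspose_re,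
      groundStateFunctional_hubbardTorusWith_pairField]
    simp
  have := groundEnergy_source_le_of_re_eq_zero (isHermitian_hubbardTorusWith L 1 U μ)
    (isHermitian_pairField_add_conjTranspose L) h0 h
  rw [← dWaveSourceTorus_eq] at this
  rwa [dWaveSourceTorus_zero]

/-- **Energy sandwich, lower half**: `E₀(H_{L,0}) - E₀(H_{L,h}) ≤ 2hL² · dWaveSourceDensity L U μ h`
(a lower bound on the order parameter from the linear energy GAIN). [cite: KomaTasaki1994, §1] -/
theorem groundEnergy_gain_le_dWaveSourceDensity (U μ h : ℝ) :
    (dWaveSourceTorus L U μ 0).groundEnergy - (dWaveSourceTorus L U μ h).groundEnergy ≤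
      2 * h * (L : ℝ) ^ 2 * dWaveSourceDensity L U μ h := by
  have := sub_groundEnergy_le_sub_mul_re_groundStateFunctional (isHermitian_hubbardTorusWith L 1 U μ)
    (isHermitian_pairField_add_conjTranspose L) h 0
  rw [← dWaveSourceTorus_eq, ← dWaveSourceTorus_eq, re_groundStateFunctional_dWaveSource_op] at this
  nlinarith [this]

/-- **Energy sandwich, upper half**: `(h' - h) · 2L² · dWaveSourceDensity L U μ h ≤ E₀(H_{L,h}) - E₀(H_{L,h'})`
(an upper bound on the order parameter from the energy DROP between `h` and `h'`, e.g. `h' = 2h`).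
[cite: KomaTasaki1994, §1] -/
theorem dWaveSourceDensity_mul_le_groundEnergy_drop (U μ h h' : ℝ) :
    (h' - h) * (2 * (L : ℝ) ^ 2 * dWaveSourceDensity L U μ h) ≤
      (dWaveSourceTorus L U μ h).groundEnergy - (dWaveSourceTorus L U μ h').groundEnergy := by
  have := sub_mul_re_groundStateFunctional_le (isHermitian_hubbardTorusWith L 1 U μ)
    (isHermitian_pairField_add_conjTranspose L) h h'
  rwa [← dWaveSourceTorus_eq, ← dWaveSourceTorus_eq, re_groundStateFunctional_dWaveSource_op] at this

end Sandwich

end Literature.MathematicalPhysics.QuantumLattice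

end
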